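import Mathlib.Analysis.Distribution.TestFunction
import Mathlib.Analysis.Distribution.AEEqOfIntegralContDiff
import Mathlib.Analysis.FunctionalSpaces.SobolevInequality
import Mathlib.MeasureTheory.Function.LocallyIntegrable
import Mathlib.Analysis.Distribution.Sobolev
import Literature.Analysis.FunctionSpaces.BesselSobolevSpace
import HarnessLib

-- provenance: harness21/H21/H21/Prelude/Sobolev/SobolevDomain.lean @ fb9c2df (interim HEAD d8f2665); M5 mechanical rewrite
/-!
# Sobolev spaces `W^{k,p}(Ω)` on open subsets via weak derivatives

Trunk: Sobolev (outline `H21/Outlines/Sobolev.md`, item C13, design decision D3; notion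
`sobolev_Wkp_domain`).

Let `E'` be a finite-dimensional real normed space with its Borel σ-algebra, `Ω : Opens E'` an
open subset, `μ` a measure on `E'` and `F` a real normed space. This file defines

* `Literature.IsTestFunctionOn Ω φ`: `φ : E' → G` is smooth, compactly supported, with
  `tsupport φ ⊆ Ω` (i.e. `φ ∈ C_c^∞(Ω; G)` as a plain function); the bridge
  `TestFunction.isTestFunctionOn` says every element of Mathlib's bundled `𝓓(Ω, G)` qualifies.
* `Literature.HasWeakFDerivOn Ω μ f g`: `g : E' → E' →L[ℝ] F` is a `μ`-weak (Fréchet) derivative of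
  `f : E' → F` on `Ω`: `∫_Ω ∂_v φ • f dμ = -∫_Ω φ • g(·) v dμ` for all real test functions `φ` on
  `Ω` and all directions `v`. For `μ = volume` (Lebesgue/Haar measure) this is the classical weak
  derivative (Evans, *PDE*, §5.2.1); for a weighted measure `μ = volume.withDensity w` it is the
  `μ`-weak derivative. The notion is only meaningful for complete `F` (Mathlib's Bochner
  integral is the junk value `0` on non-complete codomains), so every theorem whose truth
  depends on the integration-by-parts identity assumes `[CompleteSpace F]`.
* `Literature.MemSobolevDomain k p Ω μ f`: `f ∈ W^{k,p}(Ω; F)` (w.r.t. `μ`), by recursion on `k`: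
  `f ∈ L^p(Ω, μ)` and `f` has a weak derivative all of whose directional components lie in
  `W^{k-1,p}` (Evans, *PDE*, §5.2.2).
* `Literature.eSobolevDomainNorm k p Ω μ f : ℝ≥0∞`: the (extended) Sobolev norm, in the equivalent
  "sum" form `‖f‖_{L^p} + Σᵢ ‖∂ᵢ f‖_{W^{k-1,p}}` along the basis `Module.finBasis ℝ E'`
  (Brezis, *Functional Analysis*, §9.1), with an infimum over admissible weak derivatives (which
  are a.e. unique, `HasWeakFDerivOn.unique`, so the infimum is attained); for a.e.-strongly
  measurable `f` it is `< ∞` iff `f ∈ W^{k,p}` (`eSobolevDomainNorm_lt_top_iff`).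
* `Literature.MemSobolevDomainZero p Ω μ f`: `f ∈ W₀^{1,p}(Ω; F)`, the `W^{1,p}`-closure of test
  functions (Evans, *PDE*, §5.2.2; Brezis §9.4). Only `k = 1` is provided (no `k` argument;
  the outline's `MemSobolevDomainZero 1 p Ω μ f` reads `MemSobolevDomainZero p Ω μ f` here).
* `Literature.TraceData F Ω p μ σ`: a *hypothesis structure* bundling a trace operator
  `W^{1,p}(Ω) → L^p(∂Ω, σ)` with its characteristic properties (Evans, *PDE*, §5.5, Thms. 1–2).
  No trace theorem is proved here; statements needing traces take a `TraceData` argument.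

and states (proofs `sorry`) uniqueness of weak derivatives, compatibility with the classical
derivative, restriction to smaller domains, the Poincaré inequality on `W₀^{1,p}` of a bounded
domain, the Gagliardo–Nirenberg–Sobolev inequality on `W₀^{1,p}`, the Rellich–Kondrachov
compactness theorem (sequential form) and the bridge to the Bessel-potential spaces `H^{k,2}` of
Mathlib (`TemperedDistribution.MemSobolev`) on all of `E'`, for functions with values in a
complex Hilbert space `F` (where Plancherel is available).

## Design notes

* **Explicit measure.** Every predicate takes an explicit `(μ : Measure E')`; use `volume` at
  call sites. Weighted Sobolev spaces (needed later for the Lorentzian / GR families) are out of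
  scope in v0 but plug in as `μ = volume.withDensity w` with no signature change. Theorems that
  are only true for Lebesgue measure assume `[μ.IsAddHaarMeasure]`.
* **Mathlib search.** Mathlib (this pin) has bundled test functions `TestFunction Ω F n`
  (`𝓓(Ω, F)`), the uniqueness lemma `IsOpen.ae_eq_zero_of_integral_contDiff_smul_eq_zero`, the
  GNS inequality for `C¹_c` functions `MeasureTheory.eLpNorm_le_eLpNorm_fderiv_of_eq`, and
  Bessel-potential Sobolev classes `TemperedDistribution.MemSobolev` on the whole space; it has
  no weak derivatives and no `W^{k,p}(Ω)`. Mathlib's `Distribution Ω F n` is tracked, not built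
  on (outline D3). We use *plain functions* as test functions (predicate `IsTestFunctionOn`), with
  a bridge from `𝓓(Ω, G)`.
* **Recursion on `k`.** `MemSobolevDomain (k+1)` asks for a weak Fréchet derivative
  `g : E' → E' →L[ℝ] F` and recurses on the components `x ↦ g x v : E' → F` (same codomain `F`,
  so the recursion is structural and universe-monomorphic).
* `TestFunction.isTestFunctionOn` is a deliberate dot-notation extension of Mathlib's
  `TestFunction` namespace.

## References

* L. C. Evans, *Partial Differential Equations*, 2nd ed. (2010), Ch. 5.
* H. Brezis, *Functional Analysis, Sobolev Spaces and PDE* (2011), Ch. 9.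
* R. Adams, J. Fournier, *Sobolev Spaces*, 2nd ed. (2003), Ch. 3, 4, 6.
-/

noncomputable section

open MeasureTheory TopologicalSpace Filter ENNReal
open scoped ContDiff Topology Distributions NNReal

namespace Literature.Analysis.FunctionSpaces

variable {E' : Type*} [NormedAddCommGroup E'] [NormedSpace ℝ E']
variable {F : Type*} [NormedAddCommGroup F] [NormedSpace ℝ F]
variable {G : Type*} [NormedAddCommGroup G] [NormedSpace ℝ G]

/-! ### Test functions as plain functions -/

/-- `IsTestFunctionOn Ω φ`: the function `φ : E' → G` is a *test function on `Ω`*, i.e. smooth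
(`C^∞`), compactly supported, with topological support inside the open set `Ω`; informally
`φ ∈ C_c^∞(Ω; G)` extended by zero (Evans, *PDE*, §5.2.1, notation `C_c^∞(U)`). [folklore] -/
structure IsTestFunctionOn (Ω : Opens E') (φ : E' → G) : Prop where
  /-- A test function is smooth. -/
  contDiff : ContDiff ℝ ∞ φ
  /-- A test function has compact support. -/
  hasCompactSupport : HasCompactSupport φ
  /-- The support of a test function on `Ω` lies in `Ω`. -/
  tsupport_subset : tsupport φ ⊆ (Ω : Set E')

/-- The zero function is a test function on every `Ω` (Evans, *PDE*, §5.2.1). [folklore] -/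
theorem isTestFunctionOn_zero (Ω : Opens E') :
    IsTestFunctionOn Ω (0 : E' → G) where
  contDiff := contDiff_const
  hasCompactSupport := HasCompactSupport.zero
  tsupport_subset := by simp

/-- A test function on `Ω` is a test function on any larger open set (Evans, *PDE*, §5.2.1). [folklore] -/
theorem IsTestFunctionOn.mono {Ω Ω' : Opens E'} {φ : E' → G} (hφ : IsTestFunctionOn Ω φ)
    (h : Ω ≤ Ω') : IsTestFunctionOn Ω' φ :=
  ⟨hφ.contDiff, hφ.hasCompactSupport, hφ.tsupport_subset.trans h⟩

end Literature.Analysis.FunctionSpaces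

namespace TestFunction

/-- Bridge to Mathlib: every bundled test function `φ : 𝓓(Ω, G)` is a test function on `Ω` in
the sense of `Literature.Analysis.FunctionSpaces.IsTestFunctionOn` (Evans, *PDE*, §5.2.1). Deliberate dot-notation extension
of Mathlib's `TestFunction` namespace. [folklore] -/
theorem isTestFunctionOn {E' : Type*} [NormedAddCommGroup E'] [NormedSpace ℝ E']
    {G : Type*} [NormedAddCommGroup G] [NormedSpace ℝ G] {Ω : Opens E'} (φ : 𝓓(Ω, G)) :
    Literature.Analysis.FunctionSpaces.IsTestFunctionOn Ω (φ : E' → G) :=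
  ⟨φ.contDiff, φ.hasCompactSupport, φ.tsupport_subset⟩

end TestFunction

namespace Literature.Analysis.FunctionSpaces

variable {E' : Type*} [NormedAddCommGroup E'] [NormedSpace ℝ E'] [MeasurableSpace E']
variable {F : Type*} [NormedAddCommGroup F] [NormedSpace ℝ F]

/-! ### Weak derivatives -/

/-- `HasWeakFDerivOn Ω μ f g`: `g : E' → E' →L[ℝ] F` is a *weak (Fréchet) derivative* of
`f : E' → F` on the open set `Ω` with respect to the measure `μ`: both are locally integrable on
`Ω` and, for every real test function `φ` on `Ω` and every direction `v`,
`∫_Ω (∂_v φ) f dμ = -∫_Ω φ (g v) dμ` (Evans, *PDE*, §5.2.1, Definition; with all first-order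
partial derivatives bundled into one linear map). For `μ` a Haar (Lebesgue) measure this is the
classical weak derivative; for weighted `μ` it is the `μ`-weak derivative.

*Junk value:* Mathlib's Bochner integral is `0` when the codomain is not complete
(`MeasureTheory.integral_of_not_completeSpace`), so for non-complete `F` the identity
`integral_fderiv_smul_eq` is vacuous and the predicate only records local integrability; it is
meaningful (and used) only under `[CompleteSpace F]`. [folklore] -/
structure HasWeakFDerivOn (Ω : Opens E') (μ : Measure E') (f : E' → F)
    (g : E' → E' →L[ℝ] F) : Prop where
  /-- The function is locally integrable on `Ω`. -/
  locallyIntegrableOn : LocallyIntegrableOn f (Ω : Set E') μ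
  /-- The weak derivative is locally integrable on `Ω`. -/
  locallyIntegrableOn_deriv : LocallyIntegrableOn g (Ω : Set E') μ
  /-- Integration by parts against test functions. -/
  integral_fderiv_smul_eq : ∀ (φ : E' → ℝ) (v : E'), IsTestFunctionOn Ω φ →
    ∫ x in (Ω : Set E'), (fderiv ℝ φ x v) • f x ∂μ = -∫ x in (Ω : Set E'), φ x • g x v ∂μ

/-- Weak derivatives are unique `μ`-a.e. on `Ω` (Evans, *PDE*, §5.2.1, remark after the
Definition; via Mathlib's `IsOpen.ae_eq_zero_of_integral_contDiff_smul_eq_zero`). [cite: Evans2010, §5.2.1 (remark after the Definition: uniqueness of weak derivatives)] -/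
def HasWeakFDerivOn.unique : Prop :=
  ∀ [FiniteDimensional ℝ E'] [BorelSpace E'] [CompleteSpace F] {Ω : Opens E'} {μ : Measure E'} {f : E' → F} {g₁ g₂ : E' → E' →L[ℝ] F} (h₁ : HasWeakFDerivOn Ω μ f g₁) (h₂ : HasWeakFDerivOn Ω μ f g₂),
    g₁ =ᵐ[μ.restrict (Ω : Set E')] g₂

/-- A `C¹` function has its classical derivative as weak derivative on every open set, for any
additive Haar (Lebesgue) measure (Evans, *PDE*, §5.2.1, motivation: integration by parts).
`Ω` and `μ` are explicit: downstream files (`FluidKinetic/VectorCalculus`) call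
`HasWeakFDerivOn.of_contDiff ⊤ volume hu`. [cite: Evans2010, §5.2.1 (motivation: integration by parts)] -/
def HasWeakFDerivOn.of_contDiff : Prop :=
  ∀ [FiniteDimensional ℝ E'] [BorelSpace E'] (Ω : Opens E') (μ : Measure E') [μ.IsAddHaarMeasure] {f : E' → F} (hf : ContDiff ℝ 1 f),
    HasWeakFDerivOn Ω μ f (fderiv ℝ f)

/-- Restricting a weak derivative to a smaller open set (Evans, *PDE*, §5.2.1). [cite: Evans2010, §5.2.1] -/
def HasWeakFDerivOn.mono_set : Prop :=
  ∀ {Ω Ω' : Opens E'} {μ : Measure E'} {f : E' → F} {g : E' → E' →L[ℝ] F} (h : HasWeakFDerivOn Ω μ f g) (hΩ : Ω' ≤ Ω),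
    HasWeakFDerivOn Ω' μ f g

/-! ### The Sobolev classes `W^{k,p}(Ω)` -/

/-- `MemSobolevDomain k p Ω μ f`: the function `f : E' → F` lies in the Sobolev space
`W^{k,p}(Ω; F)` with respect to `μ`, i.e. `f ∈ L^p(Ω, μ)` and all weak derivatives of order
`≤ k` exist and lie in `L^p(Ω, μ)` (Evans, *PDE*, §5.2.2, Definition). Defined by recursion on
`k`: for `k + 1`, `f ∈ L^p` and `f` has a weak Fréchet derivative `g` on `Ω` all of whose
components `x ↦ g x v` lie in `W^{k,p}(Ω; F)`. [folklore] -/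
def MemSobolevDomain : ℕ → ℝ≥0∞ → Opens E' → Measure E' → (E' → F) → Prop
  | 0, p, Ω, μ, f => MemLp f p (μ.restrict Ω)
  | k + 1, p, Ω, μ, f => MemLp f p (μ.restrict Ω) ∧
      ∃ g : E' → E' →L[ℝ] F, HasWeakFDerivOn Ω μ f g ∧ ∀ v : E',
        MemSobolevDomain k p Ω μ (fun x => g x v)

/-- Unfolding `W^{0,p}(Ω) = L^p(Ω)` (Evans, *PDE*, §5.2.2). [folklore] -/
@[simp]
theorem memSobolevDomain_zero_iff {p : ℝ≥0∞} {Ω : Opens E'} {μ : Measure E'} {f : E' → F} :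
    MemSobolevDomain 0 p Ω μ f ↔ MemLp f p (μ.restrict Ω) := Iff.rfl

/-- Unfolding `W^{k+1,p}(Ω)`: `f ∈ L^p` with a weak derivative whose components are in `W^{k,p}`
(Evans, *PDE*, §5.2.2). [folklore] -/
theorem memSobolevDomain_succ_iff {k : ℕ} {p : ℝ≥0∞} {Ω : Opens E'} {μ : Measure E'}
    {f : E' → F} :
    MemSobolevDomain (k + 1) p Ω μ f ↔ MemLp f p (μ.restrict Ω) ∧
      ∃ g : E' → E' →L[ℝ] F, HasWeakFDerivOn Ω μ f g ∧ ∀ v : E',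
        MemSobolevDomain k p Ω μ (fun x => g x v) := Iff.rfl

/-- `W^{k,p}(Ω) ⊆ L^p(Ω)` (Evans, *PDE*, §5.2.2). [folklore] -/
theorem MemSobolevDomain.memLp {k : ℕ} {p : ℝ≥0∞} {Ω : Opens E'} {μ : Measure E'} {f : E' → F}
    (hf : MemSobolevDomain k p Ω μ f) : MemLp f p (μ.restrict Ω) := by
  cases k with
  | zero => exact hf
  | succ k => exact hf.1

/-- Restriction `W^{k,p}(Ω) → W^{k,p}(Ω')` for `Ω' ⊆ Ω` (Adams–Fournier, *Sobolev Spaces*,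
§3.2). [cite: AdamsFournier2003, §3.2] -/
def MemSobolevDomain.mono_set : Prop :=
  ∀ {k : ℕ} {p : ℝ≥0∞} {Ω Ω' : Opens E'} {μ : Measure E'} {f : E' → F} (hf : MemSobolevDomain k p Ω μ f) (hΩ : Ω' ≤ Ω),
    MemSobolevDomain k p Ω' μ f

/-- The extended Sobolev norm `‖f‖_{W^{k,p}(Ω)} ∈ [0, ∞]`, in the (equivalent) sum form
`‖f‖_{W^{0,p}} = ‖f‖_{L^p(Ω)}`, `‖f‖_{W^{k+1,p}} = ‖f‖_{L^p(Ω)} + inf_g Σᵢ ‖g eᵢ‖_{W^{k,p}}`,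
the infimum over weak derivatives `g` of `f` on `Ω` (a.e. unique, so attained when nonempty)
and `(eᵢ)` the basis `Module.finBasis ℝ E'` (Brezis, *Functional Analysis*, §9.1, the norm
`‖u‖_{L^p} + Σ ‖∂u/∂xᵢ‖_{L^p}`, equivalent to Evans's `ℓ^p`-norm, *PDE* §5.2.2). For `k ≥ 1`
the infimum over the empty family is `⊤`, so the value is `∞` when `f` has no weak derivative;
for a.e.-strongly measurable `f` it is `< ∞` iff `f ∈ W^{k,p}(Ω)`
(`eSobolevDomainNorm_lt_top_iff`; at `k = 0`, `eLpNorm` ignores measurability, whence the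
hypothesis). [folklore] -/
def eSobolevDomainNorm [FiniteDimensional ℝ E'] :
    ℕ → ℝ≥0∞ → Opens E' → Measure E' → (E' → F) → ℝ≥0∞
  | 0, p, Ω, μ, f => eLpNorm f p (μ.restrict Ω)
  | k + 1, p, Ω, μ, f => eLpNorm f p (μ.restrict Ω) +
      ⨅ (g : E' → E' →L[ℝ] F) (_ : HasWeakFDerivOn Ω μ f g),
        ∑ i, eSobolevDomainNorm k p Ω μ (fun x => g x (Module.finBasis ℝ E' i))

variable [FiniteDimensional ℝ E']

/-- Unfolding `‖f‖_{W^{0,p}(Ω)} = ‖f‖_{L^p(Ω)}` (Brezis, §9.1). [folklore] -/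
@[simp]
theorem eSobolevDomainNorm_zero {p : ℝ≥0∞} {Ω : Opens E'} {μ : Measure E'} {f : E' → F} :
    eSobolevDomainNorm 0 p Ω μ f = eLpNorm f p (μ.restrict Ω) := rfl

/-- The `L^p` norm is bounded by the Sobolev norm (Brezis, §9.1). [folklore] -/
theorem eLpNorm_le_eSobolevDomainNorm {k : ℕ} {p : ℝ≥0∞} {Ω : Opens E'} {μ : Measure E'}
    {f : E' → F} : eLpNorm f p (μ.restrict Ω) ≤ eSobolevDomainNorm k p Ω μ f := by
  cases k with
  | zero => exact le_rfl
  | succ k => exact le_self_add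

/-- Finiteness of the Sobolev norm characterises membership in `W^{k,p}(Ω)`
(Brezis, §9.1; Evans, *PDE*, §5.2.2). [cite: Brezis2011, §9.1] -/
def eSobolevDomainNorm_lt_top_iff : Prop :=
  ∀ {k : ℕ} {p : ℝ≥0∞} {Ω : Opens E'} {μ : Measure E'} [BorelSpace E'] {f : E' → F} (hf : AEStronglyMeasurable f (μ.restrict Ω)),
    eSobolevDomainNorm k p Ω μ f < ⊤ ↔ MemSobolevDomain k p Ω μ f

/-! ### `W₀^{1,p}(Ω)` and traces -/

/-- `MemSobolevDomainZero p Ω μ f`: `f ∈ W₀^{1,p}(Ω; F)`, the closure of the test functions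
`C_c^∞(Ω; F)` in `W^{1,p}(Ω; F)`: `f ∈ W^{1,p}(Ω)` and there are test functions `φₙ` on `Ω`
with `‖f - φₙ‖_{W^{1,p}(Ω)} → 0` (Evans, *PDE*, §5.2.2, Definition of `W₀^{k,p}`; Brezis §9.4). [folklore] -/
def MemSobolevDomainZero (p : ℝ≥0∞) (Ω : Opens E') (μ : Measure E') (f : E' → F) : Prop :=
  MemSobolevDomain 1 p Ω μ f ∧ ∃ φ : ℕ → E' → F, (∀ n, IsTestFunctionOn Ω (φ n)) ∧
    Tendsto (fun n => eSobolevDomainNorm 1 p Ω μ (f - φ n)) atTop (𝓝 0)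

/-- `W₀^{1,p}(Ω) ⊆ W^{1,p}(Ω)` (Evans, *PDE*, §5.2.2). [folklore] -/
theorem MemSobolevDomainZero.memSobolevDomain {p : ℝ≥0∞} {Ω : Opens E'} {μ : Measure E'}
    {f : E' → F} (hf : MemSobolevDomainZero p Ω μ f) : MemSobolevDomain 1 p Ω μ f :=
  hf.1

variable (F) in
/-- **Hypothesis structure** for the trace operator `T : W^{1,p}(Ω) → L^p(∂Ω, σ)` on a domain
`Ω` with boundary measure `σ` (typically the surface measure on `∂Ω = frontier Ω`): a map on
functions which is linear and bounded from `W^{1,p}(Ω, μ)` to `L^p(frontier Ω, σ)`, restricts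
smooth functions to the boundary, and whose kernel is `W₀^{1,p}(Ω)` (Evans, *PDE*, §5.5,
Theorem 1 (trace theorem) and Theorem 2 (zero-trace functions)). No trace theorem is proved in
v0; statements that need boundary values take a `TraceData` as an argument. [folklore] -/
structure TraceData (Ω : Opens E') (p : ℝ≥0∞) (μ σ : Measure E') where
  /-- The trace map on (representatives of) `W^{1,p}` functions; values off `frontier Ω` and on
  non-`W^{1,p}` inputs are irrelevant. -/
  trace : (E' → F) → (E' → F)
  /-- The operator-norm bound of the trace. -/
  bound : ℝ≥0
  /-- The trace of a `W^{1,p}` function lies in `L^p(∂Ω, σ)`. -/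
  memLp_trace : ∀ f, MemSobolevDomain 1 p Ω μ f →
    MemLp (trace f) p (σ.restrict (frontier (Ω : Set E')))
  /-- Additivity of the trace (a.e. on the boundary). -/
  trace_add : ∀ f g, MemSobolevDomain 1 p Ω μ f → MemSobolevDomain 1 p Ω μ g →
    trace (f + g) =ᵐ[σ.restrict (frontier (Ω : Set E'))] trace f + trace g
  /-- Homogeneity of the trace (a.e. on the boundary). -/
  trace_smul : ∀ (c : ℝ) f, MemSobolevDomain 1 p Ω μ f →
    trace (c • f) =ᵐ[σ.restrict (frontier (Ω : Set E'))] c • trace f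
  /-- Boundedness `‖T f‖_{L^p(∂Ω)} ≤ C ‖f‖_{W^{1,p}(Ω)}`. -/
  eLpNorm_trace_le : ∀ f, MemSobolevDomain 1 p Ω μ f →
    eLpNorm (trace f) p (σ.restrict (frontier (Ω : Set E'))) ≤
      bound * eSobolevDomainNorm 1 p Ω μ f
  /-- For `f ∈ W^{1,p}(Ω)` smooth up to the boundary (the restriction of a smooth function on
  `E'`), the trace is the restriction to the boundary. -/
  trace_of_contDiff : ∀ f, ContDiff ℝ ∞ f → MemSobolevDomain 1 p Ω μ f →
    trace f =ᵐ[σ.restrict (frontier (Ω : Set E'))] f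
  /-- The kernel of the trace is `W₀^{1,p}(Ω)`. -/
  trace_ae_eq_zero_iff : ∀ f, MemSobolevDomain 1 p Ω μ f →
    (trace f =ᵐ[σ.restrict (frontier (Ω : Set E'))] 0 ↔ MemSobolevDomainZero p Ω μ f)

/-! ### The main inequalities and compactness -/

/-- **Poincaré inequality** on `W₀^{1,p}` of a bounded open set (Evans, *PDE*, §5.6.1,
Theorem 3; Brezis, Cor. 9.19): if `Ω` is bounded and `1 ≤ p ≤ ∞` there is `C` (depending only on
`Ω`, `p`) with `‖f‖_{L^p(Ω)} ≤ C ‖Df‖_{L^p(Ω)}` for every `f ∈ W₀^{1,p}(Ω)` with weak derivative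
`Df = g` (measured in the operator norm of `g x : E' →L[ℝ] F`). Lebesgue (Haar) measure,
complete `F`, and `E'` of positive dimension (`[Nontrivial E']`: in dimension `0` the constant
`1` is a test function on `Ω = ⊤` with weak derivative `0`, a counterexample). The cited
theorems cover `1 ≤ p < n` resp. `1 ≤ p < ∞`; with the closure definition of `W₀^{1,p}` used
here the statement also holds for `p = ∞` (Lipschitz functions vanishing on `∂Ω`), so the wider
range is stated. [cite: Evans2010, §5.6.1 Theorem 3 (1 ≤ p < ∞; p = ∞ see docstring)] [cite: Brezis2011, Cor. 9.19] -/
def poincare_inequality : Prop :=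
  ∀ [BorelSpace E'] [Nontrivial E'] [CompleteSpace F] (Ω : Opens E') (hΩ : Bornology.IsBounded (Ω : Set E')) (p : ℝ≥0∞) (hp : 1 ≤ p) (μ : Measure E') [μ.IsAddHaarMeasure],
    ∃ C : ℝ≥0, ∀ (f : E' → F) (g : E' → E' →L[ℝ] F), MemSobolevDomainZero p Ω μ f →
      HasWeakFDerivOn Ω μ f g →
      eLpNorm f p (μ.restrict Ω) ≤ C * eLpNorm g p (μ.restrict Ω)

/-- **Gagliardo–Nirenberg–Sobolev inequality** on `W₀^{1,p}(Ω)` (Evans, *PDE*, §5.6.1,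
Theorem 1 and the proof of Theorem 3; Brezis, Thm. 9.9): for `1 ≤ p < n = dim E'` and the
Sobolev conjugate exponent `p* = np/(n-p)` (i.e. `1/p* = 1/p - 1/n`) there is `C` with
`‖f‖_{L^{p*}(Ω)} ≤ C ‖Df‖_{L^p(Ω)}` for all `f ∈ W₀^{1,p}(Ω)`. The `C¹_c` case is Mathlib's
`MeasureTheory.eLpNorm_le_eLpNorm_fderiv_of_eq` (stated there for `[FiniteDimensional ℝ F]`);
the codomain here is any complete `F`, which is still true (the `C¹_c` estimate
`‖φ x‖ ≤ ∫ ‖∂ᵢ φ‖` along coordinate lines needs no finite-dimensionality), and the `W₀^{1,p}`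
case follows by density. [cite: Evans2010, §5.6.1 Theorem 1] [cite: Brezis2011, Thm. 9.9] -/
def gagliardo_nirenberg_sobolev : Prop :=
  ∀ [BorelSpace E'] [CompleteSpace F] (Ω : Opens E') {p p' : ℝ≥0} (hp : 1 ≤ p) (hpn : (p : ℝ) < Module.finrank ℝ E') (hp' : (p' : ℝ)⁻¹ = (p : ℝ)⁻¹ - (Module.finrank ℝ E' : ℝ)⁻¹) (μ : Measure E') [μ.IsAddHaarMeasure],
    ∃ C : ℝ≥0, ∀ (f : E' → F) (g : E' → E' →L[ℝ] F), MemSobolevDomainZero p Ω μ f →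
      HasWeakFDerivOn Ω μ f g →
      eLpNorm f p' (μ.restrict Ω) ≤ C * eLpNorm g p (μ.restrict Ω)

/-- **Rellich–Kondrachov compactness theorem**, sequential form on `W₀^{1,p}` (Evans, *PDE*,
§5.7, Theorem 1 and the Remark following it; Brezis, Thm. 9.16 and Rem. 19; Adams–Fournier,
Thm. 6.3): on a bounded open set `Ω`, with finite-dimensional range and `1 ≤ p ≤ ∞`, every
sequence bounded in `W₀^{1,p}(Ω)` has a subsequence converging in `L^p(Ω)`. (For `W₀^{1,p}` no
boundary regularity is needed. The cited statements are for `1 ≤ p < ∞`; the case `p = ∞`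
holds as well for the closure definition of `W₀^{1,∞}` by Arzelà–Ascoli, so the full range
`1 ≤ p ≤ ∞` is stated. `[FiniteDimensional ℝ F]` implies completeness of `F`.) [cite: Evans2010, §5.7 Theorem 1 and Remark] [cite: Brezis2011, Thm. 9.16] [cite: AdamsFournier2003, Thm. 6.3] -/
def rellich_kondrachov : Prop :=
  ∀ [BorelSpace E'] [FiniteDimensional ℝ F] (Ω : Opens E') (hΩ : Bornology.IsBounded (Ω : Set E')) (p : ℝ≥0∞) (hp : 1 ≤ p) (μ : Measure E') [μ.IsAddHaarMeasure] (u : ℕ → E' → F) (hu : ∀ n, MemSobolevDomainZero p Ω μ (u n)) (M : ℝ≥0) (hM : ∀ n, eSobolevDomainNorm 1 p Ω μ (u n) ≤ M),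
    ∃ (f : E' → F) (ψ : ℕ → ℕ), StrictMono ψ ∧ MemLp f p (μ.restrict Ω) ∧
      Tendsto (fun n => eLpNorm (u (ψ n) - f) p (μ.restrict Ω)) atTop (𝓝 0)

end Literature.Analysis.FunctionSpaces

/-! ### Bridge to the Bessel-potential spaces on the whole space -/

namespace Literature.Analysis.FunctionSpaces

variable {E : Type*} [NormedAddCommGroup E] [InnerProductSpace ℝ E] [FiniteDimensional ℝ E]
  [MeasurableSpace E] [BorelSpace E]

variable {F : Type*} [NormedAddCommGroup F] [InnerProductSpace ℂ F] [CompleteSpace F]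

/-- `W^{k,2}(ℝⁿ) = H^{k}(ℝⁿ)`: for an `L²` function `f` on a finite-dimensional real inner product
space with values in a complex *Hilbert* space `F` and `k : ℕ`, `f ∈ W^{k,2}` on all of `E`
(weak derivatives, this file) iff the tempered distribution defined by `f` lies in Mathlib's
Bessel-potential class `MemSobolev k 2`, i.e. `⟨D⟩^k f ∈ L²` (Evans, *PDE*, §5.8.4, Theorem 8
"characterization of `H^k` by Fourier transform"; Adams–Fournier, Thm. 7.62; the proof is
Plancherel, whence Hilbert `F` — for a general Banach `F` the right-to-left implication fails,
matching Mathlib's `[InnerProductSpace ℂ F]` sections in `Analysis/Distribution/Sobolev`). Via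
`Literature.Analysis.FunctionSpaces.BesselSobolev.mem_range_toDistrib_iff` this identifies `W^{k,2}(E)` with the range of the
bundled space `Literature.BesselSobolev E F k 2`. [cite: Evans2010, §5.8.4 Theorem 8] [cite: AdamsFournier2003, Thm. 7.62] -/
def memSobolevDomain_univ_iff_memSobolev : Prop :=
  ∀ (k : ℕ) (f : E → F) (hf : MemLp f 2 (volume : Measure E)),
    MemSobolevDomain k 2 ⊤ volume f ↔
      TemperedDistribution.MemSobolev (k : ℝ) 2 (Lp.toTemperedDistribution (hf.toLp f))

end Literature.Analysis.FunctionSpaces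

/-! ### Discharges: restriction to smaller open sets -/

namespace Literature.Analysis.FunctionSpaces

variable {E' : Type*} [NormedAddCommGroup E'] [NormedSpace ℝ E'] [MeasurableSpace E']
variable {F : Type*} [NormedAddCommGroup F] [NormedSpace ℝ F]

/-- Discharge of `HasWeakFDerivOn.mono_set`: a weak derivative on `Ω` is a weak derivative on
every open `Ω' ⊆ Ω`. Local integrability restricts (`LocallyIntegrableOn.mono_set`); a test
function `φ` on `Ω'` is one on `Ω`, and since both integrands `∂_v φ • f` and `φ • g(·) v`
vanish off `tsupport φ ⊆ Ω' ⊆ Ω`, the set integrals over `Ω'` and over `Ω` both equal the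
integral over `E'` (no measurability of `Ω`, `Ω'` is needed). (Evans, *PDE*, §5.2.1;
Adams–Fournier, §1.62/§3.2: weak derivatives are defined against `𝓓(Ω) ⊇ 𝓓(Ω')`.) [cite: Evans2010, §5.2.1] -/
theorem HasWeakFDerivOn.mono_set_holds : HasWeakFDerivOn.mono_set (E' := E') (F := F) := by
  intro Ω Ω' μ f g h hΩ
  refine ⟨h.locallyIntegrableOn.mono_set hΩ, h.locallyIntegrableOn_deriv.mono_set hΩ, ?_⟩
  intro φ v hφ
  have hΩ' : ∀ x, x ∉ (Ω' : Set E') → x ∉ tsupport φ := fun x hx hx' => hx (hφ.tsupport_subset hx')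
  have hΩs : ∀ x, x ∉ (Ω : Set E') → x ∉ tsupport φ := fun x hx => hΩ' x fun hx' => hx (hΩ hx')
  have h1 : ∀ x, x ∉ tsupport φ → (fderiv ℝ φ x v) • f x = 0 := fun x hx => by
    simp [fderiv_of_notMem_tsupport ℝ hx]
  have h2 : ∀ x, x ∉ tsupport φ → φ x • g x v = 0 := fun x hx => by
    simp [image_eq_zero_of_notMem_tsupport hx]
  have key := h.integral_fderiv_smul_eq φ v (hφ.mono hΩ)
  rw [setIntegral_eq_integral_of_forall_compl_eq_zero fun x hx => h1 x (hΩs x hx),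
    setIntegral_eq_integral_of_forall_compl_eq_zero fun x hx => h2 x (hΩs x hx)] at key
  rw [setIntegral_eq_integral_of_forall_compl_eq_zero fun x hx => h1 x (hΩ' x hx),
    setIntegral_eq_integral_of_forall_compl_eq_zero fun x hx => h2 x (hΩ' x hx)]
  exact key

/-- Discharge of `MemSobolevDomain.mono_set`: the restriction `W^{k,p}(Ω) → W^{k,p}(Ω')` for open
`Ω' ⊆ Ω`, by induction on `k`: `L^p(Ω, μ) ⊆ L^p(Ω', μ)` since `μ|_{Ω'} ≤ μ|_{Ω}`
(`MemLp.mono_measure`), and weak derivatives restrict (`HasWeakFDerivOn.mono_set_holds`).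
Adams–Fournier, *Sobolev Spaces*, 2nd ed., §3.2 (Definition of `W^{m,p}(Ω)` via the weak
derivatives of §1.62) and §6.1 ("the linear restriction operator `i_{Ω₀} : u → u|_{Ω₀}` is
bounded from `X(Ω)` into `X(Ω₀)`", `X = W^{j,q}`, with norm `≤ 1`); in the 1st ed. (Adams 1975)
these are ¶3.1, p. 44 and ¶6.1, p. 143. [cite: AdamsFournier2003, §3.2 and §6.1 (restriction operator)] -/
theorem MemSobolevDomain.mono_set_holds : MemSobolevDomain.mono_set (E' := E') (F := F) := by
  intro k
  induction k with
  | zero =>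
    intro p Ω Ω' μ f hf hΩ
    exact (memSobolevDomain_zero_iff.1 hf).mono_measure (Measure.restrict_mono_set μ hΩ)
  | succ k ih =>
    intro p Ω Ω' μ f hf hΩ
    obtain ⟨hf0, g, hg, hgk⟩ := hf
    exact ⟨hf0.mono_measure (Measure.restrict_mono_set μ hΩ), g,
      HasWeakFDerivOn.mono_set_holds hg hΩ, fun v => ih (hgk v) hΩ⟩

end Literature.Analysis.FunctionSpaces
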